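import Literature.NumberTheory.GaloisRepresentations.ProfiniteIntersectionCocycleExtension
import Literature.NumberTheory.GaloisRepresentations.ContinuousH1
import Literature.NumberTheory.EllipticCurves.PeriodIndexCorestrictionLocal
import Literature.NumberTheory.EllipticCurves.SubgroupSelmer
import HarnessLib

/-!
# Crux `PrintCf2.SplitBadTwoRankOneOfFacts` (stmt-BirchSwinnertonDyer-20368), S3n′-FACT-FREE road, brick R3a (the LIMIT STEP), file 1:
# every class of `H¹(⋂ₖ Sₖ, M)` is restricted from some `H¹(Sₖ, M)` — the surjectivity half of `H¹(⋂ Sₖ, M) = lim→ H¹(Sₖ, M)`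
# in the `subgroupH1` / `resOfLe` dialect of `SubgroupSelmer` (targets of the local surjectivity over `K*_∞` are BORN AT A FINITE LAYER)

Cell `bsd-print-cf2`, EXTRA WIDTH seat `bsd-line-cf2-p1-w3` g13 (prover-bsd-line-cf2-p1-w3-g13-0); `--supports stmt-BirchSwinnertonDyer-20368`
(helper, Theses-free). HONEST FRAMING: nothing here closes the crux or a registered stub; BSD is not proved by any of this; no summit
statement is proved by this seat. No definition, no named fact, no `sorry`. UNCONDITIONAL and GENERIC (any compact totally disconnected
topological group `G`, any discrete `G`-module `M` with continuous orbit maps).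

WHAT. The limit step «(SUR*_n) for all deep layers `n` ⟹ (LS↑) over `K*_∞`» (memo `Cruxes/SplitBadTwoRankOneOfFacts/S3N-FACTFREE-w2g14.md`
§4 R3; consumer: -w4 g12 `UpperBaseLift.baseLift_unr₂_of_locSurj`, hypothesis `hLS`) needs that every local target
`τ ∈ H¹(ker κ ∩ D_w, M)` and every global class over `K*_∞` comes from a finite layer `κ⁻¹(pⁿℤ_p)`. Both are instances of
Serre's continuity of `H¹` in the group variable, which this file proves in the tree's `subgroupH1`/`resOfLe` currency
(the `resLe`/`subgroupRep` twin is `ThetaTransport.ProfiniteExhaustion.exists_resLe_eq_of_iInf`; the degree-2, finite-coefficient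
twin is `Literature…ProfiniteIntersectionCocycleExtension.exists_resSub_eq_of_iInf`):
* `exists_resOfLe_eq_of_iInf_le` — `G` compact totally disconnected, `M` discrete with continuous orbit maps, `S : ℕ → Subgroup G`
  antitone and closed, `H` a subgroup with `⨅ₖ Sₖ ≤ H ≤ Sₖ` for all `k` (i.e. `H = ⋂ Sₖ`, stated without casts): every
  `c ∈ H¹(H, M)` is `resOfLe M _ c'` for some `k` and some `c' ∈ H¹(Sₖ, M)`;
* `exists_resOfLe_eq_of_iInf_le_from` — the same with the stage `k ≥ n₀`;
* `continuous_smul_of_isOpen_stabilizer` — open stabilisers ⟹ continuous orbit maps (the form in which the tree's `Γ_K`-modules carry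
  the hypothesis).
Proof (Serre I §2.2 Prop. 8): a continuous crossed homomorphism `φ` on the compact `H` has finite image; an open normal `W ⊴ G`
fixes that image pointwise and has `φ = 0` on `H ∩ W`; by compactness some `Sₖ ⊆ H·W` (`exists_coe_subset_mul`); `φ̃(σ) := φ(s)` for
`σ ∈ sW` is a well-defined continuous crossed homomorphism on `Sₖ` restricting to `φ`.
presearch: Serre, Galois Cohomology I §2.2 Prop. 8 [corpus: held]; NSW (1.2.5)/(1.5.1); tree twins named above — no new fact.
beyond-print theorem: no.

References: [SerreGaloisCohomology1997] I §2.2 Prop. 8, I §5.1; [NeukirchSchmidtWingberg2008] I §2 (1.2.5), I §5; [Shatz1972] Ch. II §2.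
-/

noncomputable section

set_option linter.dupNamespace false
set_option autoImplicit false

open scoped Pointwise
open CategoryTheory Topology Filter
open Literature.NumberTheory.EllipticCurves Literature.NumberTheory.GaloisRepresentations

namespace Summit.BirchSwinnertonDyer.BirchSwinnertonDyer.Theorems.PrintCf2.LocSurjLimit

universe u

variable {G : Type u} [Group G] [TopologicalSpace G] [IsTopologicalGroup G]
  {M : Type u} [AddCommGroup M] [DistribMulAction G M] [TopologicalSpace M] [DiscreteTopology M]

omit [IsTopologicalGroup G] in
/-- Open stabilisers give continuous orbit maps `g ↦ g • m` into the discrete module `M` (the preimage of `{m'}` is empty or a left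
coset of the stabiliser of `m`). [cite: SerreGaloisCohomology1997, I §2.2 (discrete `G`-modules: continuous action ⟺ open stabilisers)] -/
theorem continuous_smul_of_isOpen_stabilizer [ContinuousMul G]
    (hstab : ∀ m : M, IsOpen (MulAction.stabilizer G m : Set G)) (m : M) :
    Continuous fun g : G ↦ g • m := by
  refine continuous_discrete_rng.2 fun a ↦ isOpen_iff_mem_nhds.2 fun g hg ↦ ?_
  rw [Set.mem_preimage, Set.mem_singleton_iff] at hg
  have hO : IsOpen ((fun x : G ↦ g⁻¹ * x) ⁻¹' (MulAction.stabilizer G m : Set G)) :=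
    (hstab m).preimage (continuous_const.mul continuous_id)
  refine Filter.mem_of_superset (hO.mem_nhds (by simp)) fun x hx ↦ ?_
  rw [Set.mem_preimage, SetLike.mem_coe, MulAction.mem_stabilizer_iff] at hx
  rw [Set.mem_preimage, Set.mem_singleton_iff, ← hg]
  conv_lhs => rw [show x = g * (g⁻¹ * x) by rw [mul_inv_cancel_left], mul_smul, hx]

variable [CompactSpace G] [TotallyDisconnectedSpace G]

/-- **Every class of `H¹(⋂ₖ Sₖ, M)` is restricted from some `H¹(Sₖ, M)`** (`G` compact totally disconnected, `M` discrete with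
continuous orbit maps, `Sₖ` antitone closed, `H` squeezed between `⨅ Sₖ` and every `Sₖ`, i.e. `H = ⋂ Sₖ`): the surjectivity half of
`H¹(⋂ Sₖ, M) = lim→ H¹(Sₖ, M)`, in the `subgroupH1`/`resOfLe` currency.
[cite: SerreGaloisCohomology1997, I §2.2 Prop. 8] [cite: NeukirchSchmidtWingberg2008, I §2 (1.2.5), I §5] -/
theorem exists_resOfLe_eq_of_iInf_le (hcont : ∀ m : M, Continuous fun g : G ↦ g • m)
    (S : ℕ → Subgroup G) (hS : Antitone S) (hcl : ∀ k, IsClosed ((S k : Subgroup G) : Set G))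
    (H : Subgroup G) (hH : ∀ k, H ≤ S k) (hHS : (⨅ k, S k) ≤ H) (c : subgroupH1 H M) :
    ∃ (k : ℕ) (c' : subgroupH1 (S k) M), resOfLe M (hH k) c' = c := by
  classical
  have hEq : H = ⨅ k, S k := le_antisymm (le_iInf hH) hHS
  subst hEq
  have hScl : IsClosed (((⨅ k, S k : Subgroup G)) : Set G) := by
    rw [Subgroup.coe_iInf]; exact isClosed_iInter hcl
  haveI : CompactSpace ↥(⨅ k, S k : Subgroup G) := isCompact_iff_compactSpace.mp hScl.isCompact
  obtain ⟨φ, hφ⟩ := oneCocycleClass_surjective (discreteTopRep (⨅ k, S k : Subgroup G) M) c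
  -- (1) the image of `φ` is finite; an open set `U₁ ∋ 1` of `G` on which every element fixes the image
  have hfin : (Set.range φ.1).Finite := (isCompact_range φ.1.continuous).finite_of_discrete
  have hU₁ : (⋂ a ∈ Set.range φ.1, {g : G | g • a = a}) ∈ 𝓝 (1 : G) := by
    refine (Filter.biInter_mem hfin).2 fun a _ ↦ ?_
    exact ((isOpen_discrete ({a} : Set M)).preimage (hcont a)).mem_nhds (by simp)
  -- (2) an open set `U₂ ∋ 1` of `G` with `φ = 0` on `(⨅ k, S k) ∩ U₂`
  have h0 : IsOpen {s : (⨅ k, S k : Subgroup G) | φ.1 s = 0} :=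
    (isOpen_discrete ({0} : Set M)).preimage φ.1.continuous
  obtain ⟨U₂, hU₂o, hU₂⟩ := isOpen_induced_iff.1 h0
  have h1U₂ : (1 : G) ∈ U₂ := by
    have : (1 : (⨅ k, S k : Subgroup G)) ∈ Subtype.val ⁻¹' U₂ := by
      rw [hU₂]; exact contOneCocycles.apply_one φ
    exact this
  -- (3) an open normal subgroup inside both
  have h1 : (1 : G) ∈ interior ((⋂ a ∈ Set.range φ.1, {g : G | g • a = a}) ∩ U₂) :=
    mem_interior_iff_mem_nhds.2 (inter_mem hU₁ (hU₂o.mem_nhds h1U₂))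
  obtain ⟨W, hW⟩ := ProfiniteGrp.exist_openNormalSubgroup_sub_open_nhds_of_one isOpen_interior h1
  have hW' : (W : Set G) ⊆ (⋂ a ∈ Set.range φ.1, {g : G | g • a = a}) ∩ U₂ := hW.trans interior_subset
  have hWfix : ∀ g ∈ W, ∀ s : (⨅ k, S k : Subgroup G), g • φ.1 s = φ.1 s := fun g hg s ↦ by
    have h := (hW' hg).1
    rw [Set.mem_iInter₂] at h
    exact h (φ.1 s) ⟨s, rfl⟩
  have hWzero : ∀ s : (⨅ k, S k : Subgroup G), (s : G) ∈ W → φ.1 s = 0 := fun s hs ↦ by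
    have h : s ∈ Subtype.val ⁻¹' U₂ := (hW' hs).2
    rw [hU₂] at h
    exact h
  -- (4) some `S k ⊆ (⨅ k, S k) · W`
  obtain ⟨k, hk⟩ := exists_coe_subset_mul S hS hcl W.toSubgroup W.isOpen
  -- representatives `s(σ) ∈ ⨅ k, S k` with `s(σ)⁻¹ σ ∈ W`
  have hrep : ∀ σ : S k, ∃ s : (⨅ k, S k : Subgroup G), ((s : G))⁻¹ * σ ∈ W := fun σ ↦ by
    obtain ⟨s, hs, w', hw', hsw⟩ := Set.mem_mul.1 (hk σ.2)
    refine ⟨⟨s, hs⟩, ?_⟩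
    change s⁻¹ * (σ : G) ∈ (W : Subgroup G)
    rw [← hsw, inv_mul_cancel_left]
    exact hw'
  choose rep hrep using hrep
  -- well-definedness: the value `φ s` does not depend on the representative
  have hwd : ∀ (σ : S k) (s : (⨅ k, S k : Subgroup G)), ((s : G))⁻¹ * σ ∈ W → φ.1 s = φ.1 (rep σ) := by
    intro σ s hs
    have hmem : ((s : G))⁻¹ * (rep σ : G) ∈ W := inv_mul_mem_of_reps (W := W.toSubgroup) hs (hrep σ)
    have hu := hWzero ⟨((s : G))⁻¹ * (rep σ : G),
      (⨅ k, S k : Subgroup G).mul_mem ((⨅ k, S k : Subgroup G).inv_mem s.2) (rep σ).2⟩ hmem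
    have e : rep σ = s * ⟨((s : G))⁻¹ * (rep σ : G),
        (⨅ k, S k : Subgroup G).mul_mem ((⨅ k, S k : Subgroup G).inv_mem s.2) (rep σ).2⟩ :=
      Subtype.ext (by change (rep σ : G) = s * (((s : G))⁻¹ * (rep σ : G)); rw [mul_inv_cancel_left])
    rw [e, φ.2, hu, map_zero, add_zero]
  -- the extended function and its properties
  have hcont' : Continuous fun σ : S k ↦ φ.1 (rep σ) := by
    refine continuous_discrete_rng.2 fun a ↦ isOpen_iff_mem_nhds.2 fun σ hσ ↦ ?_
    have hO : IsOpen {σ' : S k | ((σ : G))⁻¹ * σ' ∈ W} :=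
      W.isOpen.preimage (continuous_const.mul continuous_subtype_val)
    refine Filter.mem_of_superset (hO.mem_nhds (by simp)) fun σ' hσ' ↦ ?_
    rw [Set.mem_preimage, Set.mem_singleton_iff] at hσ ⊢
    rw [← hσ]
    have h2 : ((rep σ : G))⁻¹ * σ' ∈ W := by
      have h := W.toSubgroup.mul_mem (hrep σ) hσ'
      rwa [mul_assoc, mul_inv_cancel_left] at h
    exact (hwd σ' (rep σ) h2).symm
  have hact : ∀ (σ : S k) (t : (⨅ k, S k : Subgroup G)), (σ : G) • φ.1 t = (rep σ : G) • φ.1 t := fun σ t ↦ by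
    have e : (σ : G) = (rep σ : G) * (((rep σ : G))⁻¹ * σ) := by rw [mul_inv_cancel_left]
    conv_lhs => rw [e, mul_smul, hWfix _ (hrep σ) t]
  let ψ : contOneCocycles (discreteTopRep (S k) M) :=
    ⟨⟨fun σ ↦ φ.1 (rep σ), hcont'⟩, fun σ τ ↦ by
      change φ.1 (rep (σ * τ)) = φ.1 (rep σ) + (discreteTopRep (S k) M).ρ σ (φ.1 (rep τ))
      have hστ : ((rep σ * rep τ : (⨅ k, S k : Subgroup G)) : G)⁻¹ * ((σ * τ : S k) : G) ∈ W :=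
        mul_rep_mem (W := W.toSubgroup) (hrep σ) (hrep τ)
      rw [← hwd (σ * τ) (rep σ * rep τ) hστ, φ.2]
      congr 1
      change ((rep σ : (⨅ k, S k : Subgroup G)) : G) • φ.1 (rep τ) = ((σ : S k) : G) • φ.1 (rep τ)
      rw [hact]⟩
  refine ⟨k, oneCocycleClass _ ψ, ?_⟩
  rw [← hφ, resOfLe, resH1Hom_oneCocycleClass]
  congr 1
  refine Subtype.ext (ContinuousMap.ext fun s ↦ ?_)
  rw [pullback_resHomOfEquivariant_apply, AddMonoidHom.id_apply]
  change φ.1 (rep (subgroupInclusion (iInf_le S k) s)) = φ.1 s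
  have h1 : ((s : G))⁻¹ * (subgroupInclusion (iInf_le S k) s : G) ∈ W := by
    rw [subgroupInclusion_apply_coe, inv_mul_cancel]
    exact W.toSubgroup.one_mem
  exact (hwd _ s h1).symm

/-- **The same with the stage beyond a floor `n₀`**: `Sₖ` for `k ≥ n₀` still exhausts (restrict the witness further down the antitone
sequence; `resOfLe_comp`). [cite: SerreGaloisCohomology1997, I §2.2 Prop. 8] -/
theorem exists_resOfLe_eq_of_iInf_le_from (hcont : ∀ m : M, Continuous fun g : G ↦ g • m)
    (S : ℕ → Subgroup G) (hS : Antitone S) (hcl : ∀ k, IsClosed ((S k : Subgroup G) : Set G))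
    (H : Subgroup G) (hH : ∀ k, H ≤ S k) (hHS : (⨅ k, S k) ≤ H) (n₀ : ℕ) (c : subgroupH1 H M) :
    ∃ (k : ℕ) (_ : n₀ ≤ k) (c' : subgroupH1 (S k) M), resOfLe M (hH k) c' = c := by
  obtain ⟨k, c', hc'⟩ := exists_resOfLe_eq_of_iInf_le hcont S hS hcl H hH hHS c
  refine ⟨max n₀ k, le_max_left _ _, resOfLe M (hS (le_max_right n₀ k)) c', ?_⟩
  rw [← hc', ← AddMonoidHom.comp_apply, resOfLe_comp_holds]

omit [CompactSpace G] [TotallyDisconnectedSpace G] in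
/-- **Every stage beyond the birth stage carries a lift**: if `c` is restricted from `Sₖ` then it is restricted from every `S_{k'}`,
`k' ≥ k` (transitivity of restriction). [cite: NeukirchSchmidtWingberg2008, I §5] -/
theorem exists_resOfLe_eq_of_le {S : ℕ → Subgroup G} (hS : Antitone S) {H : Subgroup G} (hH : ∀ k, H ≤ S k)
    {k k' : ℕ} (hkk' : k ≤ k') {c : subgroupH1 H M} (hc : ∃ c' : subgroupH1 (S k) M, resOfLe M (hH k) c' = c) :
    ∃ c' : subgroupH1 (S k') M, resOfLe M (hH k') c' = c := by
  obtain ⟨c', hc'⟩ := hc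
  refine ⟨resOfLe M (hS hkk') c', ?_⟩
  rw [← hc', ← AddMonoidHom.comp_apply, resOfLe_comp_holds]

end Summit.BirchSwinnertonDyer.BirchSwinnertonDyer.Theorems.PrintCf2.LocSurjLimit

end
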